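import Summits.BirchSwinnertonDyer.BirchSwinnertonDyer.Theorems.EisensteinPrimesFullDescentOrdinaryAtThree
import HarnessLib

/-!
# At an odd prime `p`: the ordinary kernels in the currency of the assembly (the `D_p`-stable level-`p²`
# complement over the `ω`-line, its uniqueness, the `ε mod p²` action, and the non-triviality of `D_p` on
# `E[p²]/K₂`) — road «R5 / AN-5», the `p`-version of brick F3d

Cell `bsd-eis` (home `run/shared/lean/pub/bsd-eis/`), width seat `bsd-line-x1-p1-w3` (gen 13; `--supports` crux 2
`GoodLatticeBDPValue`, stmt-BirchSwinnertonDyer-19032; closes nothing by itself). The token-for-token generalisation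
`3 ↦ p` (ANY odd prime) of w4 (gen 6)'s `…FullDescentOrdinaryAtThree` (F3d), i.e. the «at `p`» glue between w4's
package `FullDescentOrdinaryNine.Rat.exists_ordinary_reduction_kernels_of_hasGoodReductionAtPrime` (already stated for
every odd `p`) and the Theorem-A assembly of width seat w7 (gen 7)'s road «R5 / AN-5» (T‴: a full-descent datum at
`5 ≤ p` under the good-lattice normalisation; HOME STATUS 2026-08-28T21:34:45Z, brick table 21:47:17Z): input `hspl` of
the splitting lemma for A-I_p (w7) and steps A3/A5 at `p` for A-II_p (this seat). THEOREMS ONLY (no definition, no named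
fact, no `sorry`); nothing here closes a stub or proves a summit statement.

* `eq_zero_of_smul_eq_of_mod_prime` — `a • y = y`, `p² • y = 0`, `a ≡ 2 (mod p)` force `y = 0`;
* `eq_of_stable_of_inf_torsionBy_eq_sq` — abstract uniqueness of the level-`p²` kernel: with an additive operator `f`
  (an inertia element at `p`), if `K ≤ A[p²]` (`#K = p²`, `C ≤ K`, `#C = p`) satisfies `f x − x ∈ K` on `A[p²]` and
  `f = a •` on `K` with `a ≡ 2 (mod p)`, then every `f`-stable `B ≤ A[p²]` with `#B = p²` and `B ⊓ A[p] = C` equals `K`;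
* `Rat.exists_mem_absInertia_val_eq_two_prime` — at the place of an odd `p`, an inertia element `τ₀` with
  `(χ̄_p(res τ₀)).val = 2` and `(χ̄_{p²}(res τ₀)).val ≡ 2 (mod p)`;
* `Rat.exists_kernel_of_omegaLine_atPrime` (**F3d-A at `p`**): for `Q ∈ E[p] ∖ 0` on which `decomp v` acts through
  `χ̄_p`, with `C = ⟨Q⟩`: a `decomp v`-stable `K₂ ≤ E[p²]` with `#K₂ = p²`, `K₂ ⊓ E[p] = C`, `p • K₂ ≤ C`, inertia trivial
  on `E[p²]/K₂` and acting on `K₂` through `χ̄_{p²}`, `decomp v` NOT trivial on `E[p²]/K₂`, and uniqueness — the SAME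
  ten conjuncts, in the same order and currency, as `Rat.exists_kernel_of_omegaLine_atThree`.

References: [SerreInventiones1972] §1.11 Prop. 11 and Cor.; [SerreLocalFields1979] IV §4 Prop. 17–18; w3 g4's memo
`AN3-StubB-elementary-road.md` §2 steps A1–A3 (at `p`), A5.
-/

set_option linter.dupNamespace false
set_option autoImplicit false

noncomputable section

open scoped Classical NNReal NumberField AddSubgroup
open NumberField IsDedekindDomain

namespace Summit.BirchSwinnertonDyer.BirchSwinnertonDyer.Theorems.FullDescentOrdinaryNine

open _root_.WeierstrassCurve Literature.NumberTheory.EllipticCurves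
  Literature.NumberTheory.GaloisRepresentations Field IsDedekindDomain.HeightOneSpectrum
  Rat.HeightOneSpectrum Literature.NumberTheory.EllipticCurves.GreenbergSelmer

/-! ## §1 Abstract uniqueness of the level-`p²` kernel -/

/-- In an additive group, `a • y = y` with `p² • y = 0` and `a ≡ 2 (mod p)` (`p` prime) forces `y = 0`
(`a − 1 ≡ 1 (mod p)` is prime to `p²`). [folklore] -/
theorem eq_zero_of_smul_eq_of_mod_prime {A : Type*} [AddCommGroup A] {p : ℕ} (hp : p.Prime) {a : ℕ}
    (ha : a % p = 2) {y : A} (h2 : (p ^ 2 : ℕ) • y = 0) (hy : a • y = y) : y = 0 := by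
  have ha2 : 2 ≤ a := by
    by_contra h
    have : a % p = a := Nat.mod_eq_of_lt (lt_of_lt_of_le (by omega) hp.two_le)
    omega
  have ha1 : 1 ≤ a := le_trans (by norm_num) ha2
  have h1 : (a - 1) • y = 0 := by
    have h : (a - 1) • y + y = y := by
      conv_rhs => rw [← hy]
      rw [← succ_nsmul, Nat.sub_add_cancel ha1]
    simpa using h
  have hcop : Nat.Coprime (a - 1) (p ^ 2) := by
    have hnd : ¬ p ∣ (a - 1) := by
      intro hd
      have hmod : 1 ≡ a [MOD p] := (Nat.modEq_iff_dvd' ha1).mpr hd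
      have h1p : 1 % p = 1 := Nat.mod_eq_of_lt hp.one_lt
      have : (1 : ℕ) % p = a % p := hmod
      rw [h1p, ha] at this
      exact absurd this (by norm_num)
    exact (((Nat.Prime.coprime_iff_not_dvd hp).mpr hnd).symm).pow_right 2
  have hdvd : addOrderOf y ∣ Nat.gcd (a - 1) (p ^ 2) :=
    Nat.dvd_gcd (addOrderOf_dvd_iff_nsmul_eq_zero.mpr h1) (addOrderOf_dvd_iff_nsmul_eq_zero.mpr h2)
  rw [hcop, Nat.dvd_one] at hdvd
  exact AddMonoid.addOrderOf_eq_one_iff.mp hdvd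

/-- **Uniqueness of the level-`p²` kernel.** Let `f` be an additive operator on `A` (an inertia element at `p`),
`C ≤ K` with `#C = p`, `#K = p²`, such that `f x − x ∈ K` for `x ∈ A[p²]` and `f x = a • x` on `K` with
`a ≡ 2 (mod p)`. Then every `f`-stable `B ≤ A[p²]` with `#B = p²` and `B ⊓ A[p] = C` equals `K`. Proof: else
`B ⊓ K = C`, so `x ↦ f x − x` maps `B` into `C` with kernel of order `≥ p`; an `f`-fixed `x ∈ B ∖ 0` has `px ∈ C ⊆ K`
fixed and multiplied by `a`, so `px = 0`, `x ∈ B ⊓ A[p] = C ⊆ K`, `x = 0`. [folklore] -/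
theorem eq_of_stable_of_inf_torsionBy_eq_sq {A : Type*} [AddCommGroup A] {p : ℕ} (hp : p.Prime) (f : A →+ A)
    {C K B : AddSubgroup A} (hCK : C ≤ K) (hB2 : B ≤ A[(p ^ 2 : ℕ)])
    (hC : Nat.card C = p) (hK : Nat.card K = p ^ 2) (hB : Nat.card B = p ^ 2) (hBC : B ⊓ A[(p : ℕ)] = C)
    (hf2 : ∀ x ∈ A[(p ^ 2 : ℕ)], f x - x ∈ K) {a : ℕ} (ha : a % p = 2) (hfK : ∀ x ∈ K, f x = a • x)
    (hfB : ∀ x ∈ B, f x ∈ B) : B = K := by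
  have hp0 : p ≠ 0 := hp.ne_zero
  have hp20 : p ^ 2 ≠ 0 := pow_ne_zero _ hp0
  haveI : Finite K := Nat.finite_of_card_ne_zero (by rw [hK]; exact hp20)
  haveI : Finite B := Nat.finite_of_card_ne_zero (by rw [hB]; exact hp20)
  haveI : Finite C := Nat.finite_of_card_ne_zero (by rw [hC]; exact hp0)
  have hCB : C ≤ B := hBC ▸ inf_le_left
  -- `D = B ⊓ K` has order `p²` or `p`
  set D := B ⊓ K with hD
  have hCD : C ≤ D := le_inf hCB hCK
  haveI : Finite D := Finite.Set.subset (K : Set A) (fun x hx ↦ (AddSubgroup.mem_inf.mp hx).2)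
  have hDdvd : Nat.card D ∣ p ^ 2 := hK ▸ AddSubgroup.card_dvd_of_le inf_le_right
  have hCdvd : p ∣ Nat.card D := hC ▸ AddSubgroup.card_dvd_of_le hCD
  by_cases hD2 : Nat.card D = p ^ 2
  · -- `D = K`, so `K ≤ B`, so `B = K`
    have hDK : D = K := AddSubgroup.eq_of_le_of_card_ge inf_le_right (by rw [hK, hD2])
    have hKB : K ≤ B := hDK ▸ inf_le_left
    exact (AddSubgroup.eq_of_le_of_card_ge hKB (by rw [hK, hB])).symm
  · exfalso
    have hDp : Nat.card D = p := by
      rw [Nat.dvd_prime_pow hp] at hDdvd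
      obtain ⟨i, hi, hDi⟩ := hDdvd
      interval_cases i
      · rw [hDi, pow_zero] at hCdvd; exact absurd (Nat.eq_one_of_dvd_one hCdvd) hp.one_lt.ne'
      · rw [hDi, pow_one]
      · exact absurd hDi hD2
    have hDC : D = C := (AddSubgroup.eq_of_le_of_card_ge hCD (by rw [hC, hDp])).symm
    -- `x ↦ f x - x` maps `B` into `C`
    have hmapC : ∀ x ∈ B, f x - x ∈ C := fun x hx ↦ by
      rw [← hDC, hD]
      exact AddSubgroup.mem_inf.mpr ⟨sub_mem (hfB x hx) hx, hf2 x (hB2 hx)⟩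
    let g : B →+ C :=
      { toFun := fun x ↦ ⟨f x - x, hmapC x x.2⟩
        map_zero' := Subtype.ext (by simp)
        map_add' := fun x y ↦ Subtype.ext (by
          simp only [AddSubgroup.coe_add, map_add, AddMemClass.mk_add_mk]
          abel) }
    -- its kernel has at least `p` elements: pick a non-zero `f`-fixed `x ∈ B`
    have hmul : Nat.card g.ker * Nat.card g.range = p ^ 2 := by
      rw [← AddSubgroup.index_ker, AddSubgroup.card_mul_index, hB]
    have hrange : Nat.card g.range ∣ p := hC ▸ AddSubgroup.card_addSubgroup_dvd_card _
    have hker : 1 < Nat.card g.ker := by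
      rcases (Nat.dvd_prime hp).mp hrange with h1 | h3
      · rw [h1, mul_one] at hmul
        rw [hmul]
        exact Nat.one_lt_pow two_ne_zero hp.one_lt
      · rw [h3, pow_two] at hmul
        have hk : Nat.card g.ker = p := Nat.eq_of_mul_eq_mul_right hp.pos hmul
        rw [hk]
        exact hp.one_lt
    haveI : Finite g.ker := Nat.finite_of_card_ne_zero (by omega)
    obtain ⟨⟨x, hxker⟩, ⟨y, hyker⟩, hxy⟩ := Finite.one_lt_card_iff_nontrivial.mp hker
    -- w.l.o.g. a non-zero element of the kernel
    obtain ⟨z, hzker, hz0⟩ : ∃ z ∈ g.ker, (z : A) ≠ 0 := by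
      by_cases hx0 : (x : A) = 0
      · refine ⟨y, hyker, fun hy0 ↦ hxy (Subtype.ext (Subtype.ext (hx0.trans hy0.symm)))⟩
      · exact ⟨x, hxker, hx0⟩
    have hfz : f z = z := by
      have h := congrArg (fun c : C ↦ (c : A)) ((AddMonoidHom.mem_ker).mp hzker)
      exact sub_eq_zero.mp h
    -- `p • z ∈ C ⊆ K` is fixed by `f` and multiplied by `a`: so `p • z = 0`
    have hz2 : (p ^ 2 : ℕ) • (z : A) = 0 := by
      have := mem_torsionBy_iff.mp (hB2 z.2); rwa [natCast_zsmul] at this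
    have hpz : (p : ℕ) • (z : A) ∈ C := by
      rw [← hBC]
      refine AddSubgroup.mem_inf.mpr ⟨AddSubgroup.nsmul_mem _ z.2 p, mem_torsionBy_iff.mpr ?_⟩
      rw [natCast_zsmul, ← mul_nsmul, ← pow_two]
      exact hz2
    have hpz0 : (p : ℕ) • (z : A) = 0 := by
      refine eq_zero_of_smul_eq_of_mod_prime hp ha ?_ ?_
      · rw [smul_smul, mul_comm, ← smul_smul, hz2, smul_zero]
      · rw [← hfK _ (hCK hpz), map_nsmul, hfz]
    -- hence `z ∈ B ⊓ A[p] = C ⊆ K`, so `f z = a • z = z` and `z = 0`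
    have hzC : (z : A) ∈ C := by
      rw [← hBC]
      exact AddSubgroup.mem_inf.mpr ⟨z.2, mem_torsionBy_iff.mpr (by rw [natCast_zsmul]; exact hpz0)⟩
    have haz : a • (z : A) = z := by rw [← hfK _ (hCK hzC), hfz]
    exact hz0 (eq_zero_of_smul_eq_of_mod_prime hp ha hz2 haz)

/-! ## §2 At the place of an odd prime `p`, in the assembly currency -/

section AtPrime

variable (W : WeierstrassCurve ℚ) [W.IsElliptic] [W.IsGloballyMinimal] (p : ℕ) [hp : Fact p.Prime]

omit hp in
/-- `2 < p` for an odd prime, as a `Fact`-free inequality. [folklore] -/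
theorem two_lt_of_prime_ne_two (hpp : p.Prime) (hp2 : p ≠ 2) : 2 < p :=
  lt_of_le_of_ne hpp.two_le (Ne.symm hp2)

/-- **An inertia element at an odd `p` acting by `2` on `μ_p` and by `a ≡ 2 (mod p)` on `μ_{p²}`.** For the place
`v` of `p`: some `τ₀ ∈ I_{ℚ_v}` has `χ̄_p(res τ₀) = 2`, hence `(χ̄_p(res τ₀)).val = 2` and
`(χ̄_{p²}(res τ₀)).val ≡ 2 (mod p)` (`χ̄_{p²} ≡ χ̄_p (mod p)`, `cast_modNCyclotomicCharacter`; inertia maps ONTO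
`(ℤ/p)ˣ`, w4 g6's `Rat.exists_mem_absInertia_modNCyclotomicCharacter_absGaloisRestrict_eq`).
[cite: SerreLocalFields1979, Ch. IV §4, Prop. 17–18] -/
theorem Rat.exists_mem_absInertia_val_eq_two_prime (hp2 : p ≠ 2) {v : HeightOneSpectrum (𝓞 ℚ)}
    (hv : natGenerator v = p) :
    ∃ τ₀ ∈ absInertia (v.adicCompletion ℚ),
      ((modNCyclotomicCharacter ℚ p (absGaloisRestrict ℚ (v.adicCompletion ℚ) τ₀) : (ZMod p)ˣ) :
        ZMod p).val = 2 ∧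
      ((modNCyclotomicCharacter ℚ (p ^ 2) (absGaloisRestrict ℚ (v.adicCompletion ℚ) τ₀) : (ZMod (p ^ 2))ˣ) :
        ZMod (p ^ 2)).val % p = 2 := by
  have hpp : p.Prime := hp.out
  have h2p : 2 < p := two_lt_of_prime_ne_two p hpp hp2
  have hcop : Nat.Coprime 2 p := (Nat.coprime_primes Nat.prime_two hpp).mpr (Ne.symm hp2)
  set u : (ZMod p)ˣ := ZMod.unitOfCoprime 2 hcop with hu
  have huval : ((u : ZMod p)).val = 2 := by
    rw [hu, ZMod.coe_unitOfCoprime, ZMod.val_natCast, Nat.mod_eq_of_lt h2p]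
  obtain ⟨τ₀, hτ₀, h⟩ := Rat.exists_mem_absInertia_modNCyclotomicCharacter_absGaloisRestrict_eq p v
    (natCast_mem_of_natGenerator_eq hv) u
  refine ⟨τ₀, hτ₀, by rw [h, huval], ?_⟩
  have hc := cast_modNCyclotomicCharacter ℚ (dvd_pow_self p two_ne_zero)
    (absGaloisRestrict ℚ (v.adicCompletion ℚ) τ₀)
  rw [h] at hc
  -- `hc : ZMod.cast (χ̄_{p²} : ZMod (p²)) = (u : ZMod p)`
  set a : ZMod (p ^ 2) := ((modNCyclotomicCharacter ℚ (p ^ 2) (absGaloisRestrict ℚ (v.adicCompletion ℚ) τ₀) :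
    (ZMod (p ^ 2))ˣ) : ZMod (p ^ 2)) with ha
  have hcast : (ZMod.cast a : ZMod p) = (a.val : ZMod p) := by
    rw [ZMod.cast_eq_val]
  rw [hcast] at hc
  have h2 : ((a.val : ℕ) : ZMod p) = ((2 : ℕ) : ZMod p) := by
    rw [hc, hu, ZMod.coe_unitOfCoprime]
  rw [ZMod.natCast_eq_natCast_iff'] at h2
  rw [h2, Nat.mod_eq_of_lt h2p]

/-- **F3d-A at an odd prime `p`: the level-`p²` kernel over the `ω`-line (input `hspl` of the splitting lemma for
Theorem A-I_p, with steps A3 and A5 at `p` for A-II_p).** `W/ℚ` globally minimal, good ordinary at the odd prime `p`,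
`v` the place of `p`, and `Q ∈ E[p] ∖ 0` on which `D_v = GreenbergSelmer.decomp v` acts through `χ̄_p`; put
`C = ⟨Q⟩ ≤ E(ℚ̄)`. Then there is `K₂ ≤ E[p²]` with: `C ≤ K₂`, `#K₂ = p²`, `K₂ ⊓ E[p] = C`, `p • K₂ ≤ C`, `K₂` stable under
`D_v`, the inertia group `I_v = GreenbergSelmer.inertia v` trivial on `E[p²]/K₂` and acting on `K₂` through `χ̄_{p²}`,
`D_v` NOT trivial on `E[p²]/K₂`, and UNIQUENESS: every `D_v`-stable `B ≤ E[p²]` of order `p²` with `B ⊓ E[p] = C` is `K₂`.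
(`K₂`, `Λ` are the kernels of reduction on `E[p²]`, `E[p]`; `Q ∈ Λ` because `res τ₀ • Q − Q = 2Q − Q ∈ Λ` for an inertia
element with `χ̄_p = 2`, so `C = Λ`; uniqueness is `eq_of_stable_of_inf_torsionBy_eq_sq` with that `τ₀`, which acts on
`K₂` by `χ̄_{p²}(res τ₀) ≡ 2 (mod p)`.) [cite: SerreInventiones1972, §1.11 Prop. 11 and Cor.] -/
theorem Rat.exists_kernel_of_omegaLine_atPrime (hp2 : p ≠ 2) (hgood : W.HasGoodReductionAtPrime p)
    (hord : ¬ ((p : ℤ) ∣ W.frobeniusTrace p)) {v : HeightOneSpectrum (𝓞 ℚ)} (hv : natGenerator v = p)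
    {Q : geomTorsion W (p : ℤ)} (hQ0 : Q ≠ 0)
    (hQ : ∀ δ ∈ decomp (K := ℚ) v,
      δ • Q = ((modNCyclotomicCharacter ℚ p δ : (ZMod p)ˣ) : ZMod p).val • Q) :
    ∃ K₂ : AddSubgroup (geomPoints W),
      (AddSubgroup.zmultiples Q).map (geomTorsion W (p : ℤ)).subtype ≤ K₂ ∧
      K₂ ≤ geomTorsion W ((p ^ 2 : ℕ) : ℤ) ∧ Nat.card K₂ = p ^ 2 ∧
      K₂ ⊓ geomTorsion W (p : ℤ) = (AddSubgroup.zmultiples Q).map (geomTorsion W (p : ℤ)).subtype ∧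
      (∀ x ∈ K₂, (p : ℤ) • x ∈ (AddSubgroup.zmultiples Q).map (geomTorsion W (p : ℤ)).subtype) ∧
      (∀ δ ∈ decomp (K := ℚ) v, ∀ x ∈ K₂, δ • x ∈ K₂) ∧
      (∀ δ ∈ inertia (K := ℚ) v, ∀ x ∈ geomTorsion W ((p ^ 2 : ℕ) : ℤ), δ • x - x ∈ K₂) ∧
      (∀ δ ∈ inertia (K := ℚ) v, ∀ x ∈ K₂,
        δ • x = ((modNCyclotomicCharacter ℚ (p ^ 2) δ : (ZMod (p ^ 2))ˣ) : ZMod (p ^ 2)).val • x) ∧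
      ¬ (∀ δ ∈ decomp (K := ℚ) v, ∀ x ∈ geomTorsion W ((p ^ 2 : ℕ) : ℤ), δ • x - x ∈ K₂) ∧
      (∀ B : AddSubgroup (geomPoints W), B ≤ geomTorsion W ((p ^ 2 : ℕ) : ℤ) → Nat.card B = p ^ 2 →
        (∀ δ ∈ decomp (K := ℚ) v, ∀ x ∈ B, δ • x ∈ B) →
        B ⊓ geomTorsion W (p : ℤ) = (AddSubgroup.zmultiples Q).map (geomTorsion W (p : ℤ)).subtype →
        B = K₂) := by
  have hpp : p.Prime := hp.out
  have hpv : ((p : ℕ) : 𝓞 ℚ) ∈ v.asIdeal := natCast_mem_of_natGenerator_eq hv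
  obtain ⟨Λ, K₂, h1, h2, h3, h4, h5, h6, h7, h8, h9, h10, h11, h12⟩ :=
    Rat.exists_ordinary_reduction_kernels_of_hasGoodReductionAtPrime W p hp2 hgood hord v hpv
  obtain ⟨τ₀, hτ₀, hval, hval2⟩ := Rat.exists_mem_absInertia_val_eq_two_prime p hp2 hv
  set C : AddSubgroup (geomPoints W) :=
    (AddSubgroup.zmultiples Q).map (geomTorsion W (p : ℤ)).subtype with hCdef
  -- `Q ∈ Λ`: `res τ₀ • Q − Q = 2Q − Q = Q ∈ Λ`
  have hQΛ : ((Q : geomPoints W)) ∈ Λ := by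
    have hd := h8 τ₀ hτ₀ (Q : geomPoints W) Q.2
    have hQτ : absGaloisRestrict ℚ (v.adicCompletion ℚ) τ₀ • Q =
        ((modNCyclotomicCharacter ℚ p (absGaloisRestrict ℚ (v.adicCompletion ℚ) τ₀) : (ZMod p)ˣ) :
          ZMod p).val • Q := hQ _ ⟨τ₀, rfl⟩
    have hQ' := congrArg (fun R : geomTorsion W (p : ℤ) ↦ (R : geomPoints W)) hQτ
    simp only [AddSubgroup.torsionBy.coe_smul] at hQ'
    rw [hQ', hval, two_nsmul, add_sub_cancel_right] at hd
    exact hd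
  -- `C = Λ`
  have hCp : Nat.card C = p := by
    rw [hCdef, ← Nat.card_congr ((AddSubgroup.zmultiples Q).equivMapOfInjective _
      (geomTorsion W (p : ℤ)).subtype_injective).toEquiv, Nat.card_zmultiples,
      addOrderOf_eq_of_ne_zero W p hQ0]
  have hCΛ : C = Λ := by
    haveI : Finite Λ := Nat.finite_of_card_ne_zero (by rw [h2]; exact hpp.ne_zero)
    refine AddSubgroup.eq_of_le_of_card_ge ?_ (by rw [h2, hCp])
    rw [hCdef, AddSubgroup.map_le_iff_le_comap]
    exact AddSubgroup.zmultiples_le_of_mem hQΛ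
  have hCK : C ≤ K₂ := by rw [hCΛ, ← h5]; exact inf_le_left
  refine ⟨K₂, hCK, h3, h4, h5.trans hCΛ.symm, ?_, ?_, ?_, ?_, ?_, ?_⟩
  · -- `p • K₂ ≤ K₂ ⊓ E[p] = C`
    intro x hx
    rw [hCΛ, ← h5]
    refine AddSubgroup.mem_inf.mpr ⟨AddSubgroup.zsmul_mem _ hx (p : ℤ), mem_torsionBy_iff.mpr ?_⟩
    have h2x : ((p ^ 2 : ℕ) : ℤ) • x = 0 := mem_torsionBy_iff.mp (h3 hx)
    rw [smul_smul, ← Nat.cast_mul, ← pow_two]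
    exact h2x
  · rintro δ ⟨τ, rfl⟩ x hx
    exact h7 τ x hx
  · rintro δ hδ x hx
    obtain ⟨τ, hτ, rfl⟩ := Subgroup.mem_map.mp hδ
    exact h9 τ hτ x hx
  · rintro δ hδ x hx
    obtain ⟨τ, hτ, rfl⟩ := Subgroup.mem_map.mp hδ
    exact h10 τ hτ x hx
  · intro H
    exact h12 fun σ x hx ↦ H _ ⟨σ, rfl⟩ x hx
  · intro B hB2 hBcard hBstab hBC
    exact eq_of_stable_of_inf_torsionBy_eq_sq hpp
      (DistribSMul.toAddMonoidHom (geomPoints W) (absGaloisRestrict ℚ (v.adicCompletion ℚ) τ₀))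
      hCK hB2 hCp h4 hBcard hBC (fun x hx ↦ h9 τ₀ hτ₀ x hx) hval2 (fun x hx ↦ h10 τ₀ hτ₀ x hx)
      (fun x hx ↦ hBstab _ ⟨τ₀, rfl⟩ x hx)

end AtPrime

end Summit.BirchSwinnertonDyer.BirchSwinnertonDyer.Theorems.FullDescentOrdinaryNine

end
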